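import Summits.BirchSwinnertonDyer.BirchSwinnertonDyer.Theorems.PublishedInputsGreenbergSelmerCoinvariantsOrdinary
import Summits.BirchSwinnertonDyer.BirchSwinnertonDyer.Theorems.ByReductionTypeAtTwoGoodOrdTowerControlAllP
import Literature.NumberTheory.EllipticCurves.Greenberg1999.ControlLocalKernelsLayerGoodProofs
import Literature.NumberTheory.EllipticCurves.IwasawaTowerTorsionProofs
import Literature.NumberTheory.EllipticCurves.SelmerCorankControlRatProofs
import HarnessLib

set_option linter.dupNamespace false -- `…BirchSwinnertonDyer.BirchSwinnertonDyer…` is the cell's nested layout (D-0017)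
set_option autoImplicit false

/-!
# Greenberg LNM 1716 Lemma 4.7 with `E(F)[p] = 0`: the EXACT count `#ker g₀ = ∏_{v ∈ Σ} #𝒦_{v,0}[p^∞]` (= `#ker r₀`)
# from Cassels' theorem, and Theorem 4.1 over `ℚ` at a good ORDINARY prime MODULO the local orders

Seat `bsd-inputs-k4-p1` (gen 4; LADDER-BSD D-0154 KEY (147)(f) «prove the printed input», row 1 K4 INPUTS; Greenberg
1999), `--supports stmt-BirchSwinnertonDyer-20309`. THEOREMS ONLY (no definition, no named fact, no `sorry`).

R. Greenberg, *Iwasawa theory for elliptic curves*, LNM 1716 (1999), §4 pp. 104–108: `g₀ : 𝒢_E^Σ(F) → 𝒢_E^Σ(F_∞)` and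
`r₀ : 𝒫_E^Σ(F) → 𝒫_E^Σ(F_∞)` sit in `0 → ker g → ker r → ker t → 0` (p. 108, snake), `t` living on `𝒫^Σ(F)/𝒢^Σ(F) ≅ (E(F)_p)^`
(Cassels, p. 104 / Prop. 4.13). Hence (Lemma 4.7) `#ker g = #ker r · #(Sel_∞)_Γ / #E(F)_p`, and when `E(F)[p] = 0` simply
**`ker g₀ ≅ ker r₀ = ∏_{v ∈ Σ} ker r_v`**. The tree renders `ker g₀` as `A₀/Sel₀` (`WeierstrassCurve.KerG κ 0`,
`A₀ = h₀⁻¹(Sel_∞)`) and `ker r_v` as the `p`-power torsion of the local tower kernel `𝒦_{v,0}[p^∞]`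
(`WeierstrassCurve.localTowerKerPrimary κ K_v 0`); the file `IwasawaSelmerControlExactCountProofs` records that exactly this
bridge «needs Cassels' theorem … and the surjectivity … over `F_∞`; neither is in the tree». Cassels is now a tree THEOREM
for every number field (`InputsPoitouTateSelmer.casselsSurjectivity_H1Sigma_holds`, cell bsd-schneider/bsd-inputs), so:

* §1 `natCard_kerG_zero_eq_prod` — for EVERY number field `K : Type`, elliptic `W/K`, prime `p`, CYCLOTOMIC `κ`, with
  `Sel_{p^∞}(E/K)` finite and `E[p^∞]^{Γ_K} = 0`, and every finite `S` containing the bad places and the places above `p`: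
  **`#(A₀/Sel₀) = ∏_{v ∈ S} #𝒦_{v,0}[p^∞]`**. The evaluation map `Φ : A₀ → ∏_{v∈S} 𝒦_{v,0}[p^∞]`, `y ↦ (loc_v y)_v`
  (`localResOver_conjH1_mem_localTowerKer_of_mem`) has kernel `Sel₀` (`mem_selmerLayer_of_forall_localResOver_conjH1_eq_zero`,
  `𝒦_{v,0}[p^∞] = 0` at good `v ∤ p`: `Greenberg1999.localTowerKerPrimary_eq_bot_of_hasGoodReductionAt`) and is ONTO by
  Cassels: prescribe the local classes `x_v` on `S` and `0` at `∞`; the resulting `y ∈ H¹(K_S/K, E[p^∞])` restricts into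
  `A₀` (its restriction to `K_∞` is Selmer: at `v ∈ S` because `x_v` dies over `K_{∞,η}`, off `S` because unramified
  classes are Kummer over the cyclotomic tower — `unramKer_le_localKerOver_of_isCyclotomic`, at `∞` by the choice `0`).
* §2 `constantCoeff_charGenerator_eq_ordinary_rat` — **Greenberg's Theorem 4.1 over `ℚ` at a good ORDINARY `p` with
  `E(ℚ)[p] = 0`, MODULO THE LOCAL ORDERS**: for `W/ℚ` globally minimal, `GoodOrd W p`, `κ` cyclotomic with topological
  generator `γ`, `Sel_{p^∞}(E/ℚ)` finite, `E(ℚ)[p] = 0`, any Pontryagin-dual datum `D` with `char X(E/ℚ_∞) = (f)` and any finite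
  `S ⊇ {bad} ∪ {p}`: **`f(0) = u · #Sel_{p^∞}(E/ℚ) · ∏_{v ∈ S} #𝒦_{v,0}[p^∞]`**, `u ∈ ℤ_pˣ` — the tree's Lemma 4.2/4.3 assembly
  (`SelmerDualData.constantCoeff_charGenerator_mul_natCard_of_finite_selmerGroup_of_no_pTorsion`) × this seat's
  `(Sel_∞)_γ = 0` (`InputsGreenbergSelmerCoinv.natCard_endCoinvariants_conjSelmerInfty_ordinary_rat`, p640331) × §1. What is
  left of Thm. 4.1 (`f_E(0) ∼ ∏ c_v^{(p)} · #Ẽ(𝔽_p)_p² · #Sel_E(ℚ)_p`, p. 102) is exactly the two LOCAL orders: Lemma 3.3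
  `#𝒦_{v,0}[p^∞] = c_v^{(p)}` (`v ∤ p`) and Lemma 3.4 `#𝒦_{p,0}[p^∞] = #Ẽ(𝔽_p)_p²` (named fact
  `Greenberg1999.lemma34_natCard_localTowerKerPrimary_eq_rat`).

HONEST FRAMING: §1 is Greenberg's Lemma 4.7 in the regime `E(F)[p] = 0` (no `(Sel_∞)_Γ`, no `E(F)_p` factor), re-derived
from tree theorems; §2 is a composition; Thm. 4.1 itself is NOT proved here (two local counts outstanding) and the general
case `E(ℚ)[p] ≠ 0` is untouched; no item is closed; no summit statement is proved; BSD is not proved by any of this.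

References: [GreenbergLNM1716] §3 Lemmas 3.3–3.5 (pp. 86–90), §4 Thm. 4.1, Lemmas 4.2–4.7 (pp. 102–108), Prop. 4.13 (p. 122);
[GreenbergVatsal2000] §2 pp. 16–17; [MilneADT2006] I Thm. 4.10, Cor. 6.23.
-/

noncomputable section

open scoped Classical NumberField

open NumberField IsDedekindDomain Field

namespace Summit.BirchSwinnertonDyer.BirchSwinnertonDyer.Theorems.InputsGreenbergKerG

open Literature.NumberTheory.EllipticCurves Literature.NumberTheory.GaloisRepresentations
  WeierstrassCurve ZpExtension Literature.NumberTheory.EllipticCurves.IwasawaAlgebra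
  Literature.NumberTheory.EllipticCurves.IwasawaDual
  Literature.NumberTheory.EllipticCurves.GreenbergVatsal2000 Literature.NumberTheory.EllipticCurves.GreenbergSelmer
  Literature.NumberTheory.EllipticCurves.Rank1Residual Summit.BirchSwinnertonDyer.Rank1Residual.X2

variable {K : Type} [Field K] [NumberField K] (W : WeierstrassCurve K) [W.IsElliptic] (p : ℕ) [hp : Fact p.Prime]
  (κ : ZpExtension K p)

/-! ## §1 `#ker g₀ = ∏_{v ∈ S} #𝒦_{v,0}[p^∞]` from Cassels' theorem -/

set_option maxHeartbeats 1600000 in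
/-- **Greenberg LNM 1716 Lemma 4.7 with `E(F)[p] = 0`: `#(A₀/Sel₀) = ∏_{v ∈ S} #𝒦_{v,0}[p^∞]`** (`= #ker r₀`), for `W/K`
elliptic over a number field, `κ` the CYCLOTOMIC `ℤ_p`-extension, `Sel_{p^∞}(E/K)` finite, `#E[p^∞]^{Γ_K} = 1`, and `S` a finite
set of finite places off which `E` has good reduction and `v ∤ p`. The evaluation map `A₀ → ∏_{v ∈ S} 𝒦_{v,0}[p^∞]` has kernel
`Sel₀` and is onto by Cassels' theorem (see the module docstring). [cite: GreenbergLNM1716, §4 p. 104, Lemma 4.7 (pp. 107–108),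
Prop. 4.13 (p. 122); §3 p. 90] [cite: GreenbergVatsal2000, §2 pp. 16–17] -/
theorem natCard_kerG_zero_eq_prod (hκ : κ.IsCyclotomic) (hSel : Finite (W.selmerGroupPInfty p))
    (hE : Nat.card (MulAction.fixedPoints (absoluteGaloisGroup K) (W.geomPrimaryTorsion p)) = 1)
    (S : Finset (HeightOneSpectrum (𝓞 K)))
    (hS : ∀ v ∉ S, ((p : ℕ) : 𝓞 K) ∉ v.asIdeal ∧ W.HasGoodReductionAt v) :
    Nat.card (W.KerG κ 0) = ∏ v ∈ S, Nat.card (W.localTowerKerPrimary κ (v.adicCompletion K) 0) := by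
  -- notation
  let A : AddSubgroup (W.subgroupH1 p (κ.layerSubgroup 0)) := W.selmerInftyPreimage κ 0
  let Sel₀ : AddSubgroup (W.subgroupH1 p (κ.layerSubgroup 0)) := W.selmerLayer κ 0
  let T : HeightOneSpectrum (𝓞 K) → Type := fun v ↦ W.localTowerKerPrimary κ (v.adicCompletion K) 0
  let loc : ∀ v : HeightOneSpectrum (𝓞 K), W.subgroupH1 p (κ.layerSubgroup 0) →+
      discreteH1 (localSubgroup (κ.layerSubgroup 0) (v.adicCompletion K)) (localPoints W (v.adicCompletion K)) :=
    fun v ↦ W.localResOver p (κ.layerSubgroup 0) (v.adicCompletion K)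
  have hone : ∀ y : W.subgroupH1 p (κ.layerSubgroup 0), W.conjH1 p (κ.layerSubgroup 0) 1 y = y := fun y ↦ by
    rw [W.conjH1_one_holds p (κ.layerSubgroup 0), AddMonoidHom.id_apply]
  -- `loc_v y ∈ 𝒦_{v,0}[p^∞]` for `y ∈ A₀`
  have hmemT : ∀ (y : W.subgroupH1 p (κ.layerSubgroup 0)), y ∈ A → ∀ v, loc v y ∈ W.localTowerKerPrimary κ (v.adicCompletion K) 0 := by
    intro y hy v
    obtain ⟨k, hk⟩ := W.exists_pow_smul_subgroupH1_layer_eq_zero κ 0 y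
    refine (W.mem_localTowerKerPrimary_iff κ _ 0 _).mpr ⟨?_, k, by rw [← map_nsmul, hk, map_zero]⟩
    have h := W.localResOver_conjH1_mem_localTowerKer_of_mem κ hy v 1
    rwa [hone] at h
  -- the evaluation map `Φ : A₀ → ∏_{v ∈ S} 𝒦_{v,0}[p^∞]`
  let Φ : A →+ (∀ v : S, T v) :=
    { toFun := fun y v ↦ ⟨loc v y, hmemT y y.2 v⟩
      map_zero' := funext fun v ↦ Subtype.ext (by simp)
      map_add' := fun y y' ↦ funext fun v ↦ Subtype.ext (by simp) }
  have hΦ : ∀ (y : A) (v : S), ((Φ y v : T v) : _) = loc v y := fun _ _ ↦ rfl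
  -- `ker Φ = Sel₀`
  have h0 : ∀ v ∉ S, W.localTowerKerPrimary κ (v.adicCompletion K) 0 = ⊥ := fun v hv ↦
    Greenberg1999.localTowerKerPrimary_eq_bot_of_hasGoodReductionAt W κ (hS v hv).1 (hS v hv).2 0
  have hker : ∀ y : A, Φ y = 0 ↔ (y : W.subgroupH1 p (κ.layerSubgroup 0)) ∈ Sel₀ := by
    intro y
    constructor
    · intro hy0
      refine W.mem_selmerLayer_of_forall_localResOver_conjH1_eq_zero κ S h0 (fun _ ↦ {1}) (fun v _ σ ↦ ?_) y.2 ?_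
      · refine ⟨1, Finset.mem_singleton_self _, 1, σ, ?_, by rw [map_one, one_mul, one_mul]⟩
        rw [ZpExtension.layerSubgroup_zero]; exact Subgroup.mem_top σ
      · intro v hv ρ hρ
        rw [Finset.mem_singleton] at hρ
        rw [hρ, hone]
        have h : ((Φ y ⟨v, hv⟩ : T v) : discreteH1 (localSubgroup (κ.layerSubgroup 0) (v.adicCompletion K))
            (localPoints W (v.adicCompletion K))) = 0 := by
          rw [hy0]; rfl
        rw [hΦ] at h
        exact h
    · intro hy
      funext v
      apply Subtype.ext
      rw [hΦ]
      change loc v y = 0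
      have h := ((W.mem_selmerGroupOver_iff p (κ.layerSubgroup 0) _).mp hy).1 v 1
      rwa [hone, mem_localKerOver_iff] at h
  -- the induced map on `A₀/Sel₀` is injective
  have hle : Sel₀.addSubgroupOf A ≤ Φ.ker := fun y hy ↦ (AddMonoidHom.mem_ker).mpr ((hker y).mpr hy)
  let Ψ : W.KerG κ 0 →+ (∀ v : S, T v) := QuotientAddGroup.lift (Sel₀.addSubgroupOf A) Φ hle
  have hΨmk : ∀ y : A, Ψ (y : W.KerG κ 0) = Φ y := fun y ↦ QuotientAddGroup.lift_mk _ hle y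
  have hinj : Function.Injective Ψ := by
    refine (injective_iff_map_eq_zero Ψ).mpr fun q hq ↦ ?_
    induction q using QuotientAddGroup.induction_on with
    | H y =>
      rw [hΨmk] at hq
      exact (QuotientAddGroup.eq_zero_iff y).mpr ((hker y).mp hq)
  -- ONTO, by Cassels
  have hsurj : Function.Surjective Ψ := by
    intro x
    -- transports between the layer-`0` groups and the groups at `⊤`
    have hgeK : (⊤ : Subgroup (absoluteGaloisGroup K)) ≤ κ.layerSubgroup 0 := by rw [ZpExtension.layerSubgroup_zero]
    have hge : ∀ (E : Type) [Field E] [Algebra K E],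
        localSubgroup (⊤ : Subgroup (absoluteGaloisGroup K)) E ≤ localSubgroup (κ.layerSubgroup 0) E :=
      fun E _ _ ↦ Subgroup.comap_mono hgeK
    have hleL : ∀ (E : Type) [Field E] [Algebra K E],
        localSubgroup (κ.layerSubgroup 0) E ≤ localSubgroup (⊤ : Subgroup (absoluteGaloisGroup K)) E :=
      fun E _ _ ↦ Subgroup.comap_mono le_top
    -- the local classes to prescribe
    let xS : ∀ v : HeightOneSpectrum (𝓞 K),
        discreteH1 (localSubgroup (⊤ : Subgroup (absoluteGaloisGroup K)) (v.adicCompletion K))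
          (localPoints W (v.adicCompletion K)) := fun v ↦
      if h : v ∈ S then Literature.NumberTheory.EllipticCurves.resOfLe (localPoints W (v.adicCompletion K))
        (hge (v.adicCompletion K)) ((x ⟨v, h⟩ : T v) : _) else 0
    have hxS : ∀ v (h : v ∈ S), xS v = Literature.NumberTheory.EllipticCurves.resOfLe (localPoints W (v.adicCompletion K))
        (hge (v.adicCompletion K)) ((x ⟨v, h⟩ : T v) : _) := fun v h ↦ dif_pos h
    have hxS_tor : ∀ v, ∃ k : ℕ, p ^ k • xS v = 0 := fun v ↦ by
      by_cases h : v ∈ S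
      · obtain ⟨-, k, hk⟩ := (W.mem_localTowerKerPrimary_iff κ _ 0 _).mp (x ⟨v, h⟩).2
        exact ⟨k, by rw [hxS v h, ← map_nsmul, hk, map_zero]⟩
      · rw [show xS v = 0 from dif_neg h]; exact ⟨0, smul_zero _⟩
    let xi : ∀ w : InfinitePlace K,
        discreteH1 (localSubgroup (⊤ : Subgroup (absoluteGaloisGroup K)) w.Completion) (localPoints W w.Completion) :=
      fun _ ↦ 0
    obtain ⟨y, hyH, hyfin, hyinf⟩ := InputsPoitouTateSelmer.casselsSurjectivity_H1Sigma_holds K W p hSel hE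
      (↑S : Set (HeightOneSpectrum (𝓞 K))) S.finite_toSet
      (fun v hv hpv ↦ (hS v (fun h ↦ hv (Finset.mem_coe.mpr h))).2) xS xi hxS_tor (fun _ ↦ ⟨0, smul_zero _⟩)
    -- `y₀ = res y ∈ H¹(K_0, E[p^∞])` and its image in `H¹(K_∞, E[p^∞])`
    let y₀ : W.subgroupH1 p (κ.layerSubgroup 0) := W.resOfLe p (le_top : κ.layerSubgroup 0 ≤ ⊤) y
    have hh : W.layerToInfty κ 0 y₀ = W.resOfLe p (le_top : κ.kerSubgroup ≤ ⊤) y := by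
      change (W.resOfLe p (κ.kerSubgroup_le_layerSubgroup 0)) (W.resOfLe p (le_top : κ.layerSubgroup 0 ≤ ⊤) y) = _
      rw [← AddMonoidHom.comp_apply, W.resOfLe_comp_holds p]
    -- the local restrictions of `res y` over `K_∞` vanish at `v ∈ S` and at `∞`
    have hlocS : ∀ v ∈ S, W.resOfLe p (le_top : κ.kerSubgroup ≤ ⊤) y ∈ W.localKerOver p κ.kerSubgroup (v.adicCompletion K) := by
      intro v hv
      rw [mem_localKerOver_iff]
      change W.localResOverOfEmb p κ.kerSubgroup (closureEmb (K := K) (v.adicCompletion K)) _ = 0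
      rw [W.localResOverOfEmb_resOfLe p (closureEmb (K := K) (v.adicCompletion K)) (le_top : κ.kerSubgroup ≤ ⊤) y]
      change Literature.NumberTheory.EllipticCurves.resOfLe _ _ (W.localResOver p ⊤ (v.adicCompletion K) y) = 0
      rw [hyfin v (Or.inl (Finset.mem_coe.mpr hv)), hxS v hv, ← AddMonoidHom.comp_apply,
        Literature.NumberTheory.EllipticCurves.resOfLe_comp_holds]
      exact ((W.mem_localTowerKerPrimary_iff κ _ 0 _).mp (x ⟨v, hv⟩).2).1
    have hlocinf : ∀ w : InfinitePlace K,
        W.resOfLe p (le_top : κ.kerSubgroup ≤ ⊤) y ∈ W.localKerOver p κ.kerSubgroup w.Completion := by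
      intro w
      rw [mem_localKerOver_iff]
      change W.localResOverOfEmb p κ.kerSubgroup (closureEmb (K := K) w.Completion) _ = 0
      rw [W.localResOverOfEmb_resOfLe p (closureEmb (K := K) w.Completion) (le_top : κ.kerSubgroup ≤ ⊤) y]
      change Literature.NumberTheory.EllipticCurves.resOfLe _ _ (W.localResOver p ⊤ w.Completion y) = 0
      rw [hyinf w, map_zero]
    -- hence `res y ∈ Sel_{p^∞}(E/K_∞)`, i.e. `y₀ ∈ A₀`
    have hy₀ : y₀ ∈ A := by
      rw [W.mem_selmerInftyPreimage_iff κ 0, hh]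
      change W.resOfLe p (le_top : κ.kerSubgroup ≤ ⊤) y ∈ W.selmerGroupOver p κ.kerSubgroup
      have hyH' : W.resOfLe p (le_top : κ.kerSubgroup ≤ ⊤) y ∈
          unramifiedOutside κ.kerSubgroup (W.geomPrimaryTorsion p) p (↑S : Set (HeightOneSpectrum (𝓞 K))) :=
        SSFlatEC.resOfLe_mem_unramifiedOutside (W.geomPrimaryTorsion p) (le_top : κ.kerSubgroup ≤ ⊤) p _ hyH
      have honeK : ∀ {B : AddSubgroup (W.subgroupH1 p κ.kerSubgroup)} {z : W.subgroupH1 p κ.kerSubgroup},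
          W.conjH1 p κ.kerSubgroup 1 z ∈ B → z ∈ B := fun {B z} h ↦ by
        rwa [W.conjH1_one_holds p κ.kerSubgroup, AddMonoidHom.id_apply] at h
      refine (W.mem_selmerGroupOver_iff p κ.kerSubgroup _).mpr ⟨fun v σ ↦ ?_, fun w σ ↦ ?_⟩
      · rw [SSFlatEC.conjH1_resOfLe_top W κ σ y]
        by_cases hv : v ∈ S
        · exact hlocS v hv
        · exact GreenbergVatsalUnramifiedAway.unramKer_le_localKerOver_of_isCyclotomic (κ := κ) (v := v) (W := W)
            (p := p) hκ (hS v hv).2 (hS v hv).1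
            (honeK ((mem_unramifiedOutside_iff _).mp hyH' v (fun h ↦ hv (Finset.mem_coe.mp h)) (hS v hv).1 1))
      · rw [SSFlatEC.conjH1_resOfLe_top W κ σ y]
        exact hlocinf w
    -- and `Φ y₀ = x`
    refine ⟨((⟨y₀, hy₀⟩ : A) : W.KerG κ 0), ?_⟩
    rw [hΨmk]
    funext v
    apply Subtype.ext
    rw [hΦ]
    change W.localResOverOfEmb p (κ.layerSubgroup 0) (closureEmb (K := K) (v.1.adicCompletion K)) y₀ = _
    rw [W.localResOverOfEmb_resOfLe p (closureEmb (K := K) (v.1.adicCompletion K)) (le_top : κ.layerSubgroup 0 ≤ ⊤) y]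
    change Literature.NumberTheory.EllipticCurves.resOfLe _ _ (W.localResOver p ⊤ (v.1.adicCompletion K) y) = _
    rw [hyfin v.1 (Or.inl (Finset.mem_coe.mpr v.2)), hxS v.1 v.2]
    have e1 := congrArg (fun f ↦ f ((x v : T v) : _))
      (Literature.NumberTheory.EllipticCurves.resOfLe_comp_holds (M := localPoints W (v.1.adicCompletion K))
        (hleL (v.1.adicCompletion K)) (hge (v.1.adicCompletion K)))
    have e2 := congrArg (fun f ↦ f ((x v : T v) : _))
      (Literature.NumberTheory.EllipticCurves.resOfLe_refl_holds (M := localPoints W (v.1.adicCompletion K))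
        (localSubgroup (κ.layerSubgroup 0) (v.1.adicCompletion K)))
    exact e1.trans e2
  -- count
  rw [Nat.card_congr (Equiv.ofBijective Ψ ⟨hinj, hsurj⟩), Nat.card_pi]
  exact Finset.prod_coe_sort S (fun v ↦ Nat.card (W.localTowerKerPrimary κ (v.adicCompletion K) 0))

/-! ## §2 Theorem 4.1 over `ℚ` at a good ordinary prime, modulo the local orders -/

/-- **Greenberg LNM 1716 Thm. 4.1 over `ℚ` at a good ORDINARY `p` with `E(ℚ)[p] = 0`, modulo the local orders**: for `W/ℚ`
globally minimal and elliptic, `GoodOrd W p`, `κ` the cyclotomic `ℤ_p`-extension with topological generator `γ`,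
`Sel_{p^∞}(E/ℚ)` finite, `E(ℚ)[p] = 0`, a Pontryagin-dual datum `D` of `Sel_{p^∞}(E/ℚ_∞)` with `char(X) = (f)`, and any finite `S`
containing the bad primes and `p`: `X` is finitely generated `Λ`-torsion and
**`f(0) = u · #Sel_{p^∞}(E/ℚ) · ∏_{v ∈ S} #𝒦_{v,0}[p^∞]`** for a unit `u ∈ ℤ_pˣ`. Assembly: Lemmas 4.2/4.3
(`…_of_finite_selmerGroup_of_no_pTorsion`), `(Sel_∞)_γ = 0` (`natCard_endCoinvariants_conjSelmerInfty_ordinary_rat`) and §1.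
The two local orders (`c_v^{(p)}` at `v ∤ p`, Lemma 3.3; `#Ẽ(𝔽_p)_p²` at `p`, Lemma 3.4) are NOT evaluated here.
[cite: GreenbergLNM1716, §4 Thm. 4.1 (p. 102), Lemmas 4.2–4.7 (pp. 102–108)] -/
theorem constantCoeff_charGenerator_eq_ordinary_rat (W : WeierstrassCurve ℚ) [W.IsGloballyMinimal] [W.IsElliptic]
    (hgo : GoodOrd W p) (κ : ZpExtension ℚ p) (hκ : κ.IsCyclotomic) {γ : absoluteGaloisGroup ℚ} (hγ : κ.IsTopGenerator γ)
    (D : W.SelmerDualData κ γ) [Finite (W.selmerGroupPInfty p)] (hK : ∀ P : W.toAffine.Point, p • P = 0 → P = 0)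
    (S : Finset (HeightOneSpectrum (𝓞 ℚ))) (hS : ∀ v ∉ S, ((p : ℕ) : 𝓞 ℚ) ∉ v.asIdeal ∧ W.HasGoodReductionAt v)
    (f : IwasawaAlgebra p) (hf : Module.charIdeal (IwasawaAlgebra p) D.X = Ideal.span {f}) :
    Module.Finite (IwasawaAlgebra p) D.X ∧ Module.IsTorsion (IwasawaAlgebra p) D.X ∧
      ∃ u : ℤ_[p]ˣ, PowerSeries.constantCoeff f =
        u * Nat.card (W.selmerGroupPInfty p) * ∏ v ∈ S, Nat.card (W.localTowerKerPrimary κ (v.adicCompletion ℚ) 0) := by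
  -- `ker g₀` is finite (Lemma 3.3 at `v ∤ p`, the bsd-2adic layer bound at `v ∣ p`)
  have hg : Finite (W.KerG κ 0) :=
    W.finite_kerG_zero_of_finite_localTowerKerPrimary_dvd κ fun v hpv ↦ by
      obtain ⟨C, hC⟩ := GoodOrdTower.exists_natCard_localTowerKerPrimary_le W hgo κ hκ v hpv
      exact (hC 0).1
  -- (`convert` bridges the two `DecidableEq ℚ` instances behind the group law on `W.toAffine.Point`)
  have hE : Nat.card (MulAction.fixedPoints (absoluteGaloisGroup ℚ) (W.geomPrimaryTorsion p)) = 1 :=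
    W.natCard_fixedPoints_absoluteGaloisGroup_geomPrimaryTorsion_eq_one (p := p) fun P hP ↦ hK P (by convert hP)
  obtain ⟨hFG, hX, -, -, -, u, hu⟩ :=
    D.constantCoeff_charGenerator_mul_natCard_of_finite_selmerGroup_of_no_pTorsion W hγ ‹_› hg
      (fun P hP ↦ hK P (by convert hP)) f hf
  refine ⟨hFG, hX, u, ?_⟩
  rw [InputsGreenbergSelmerCoinv.natCard_endCoinvariants_conjSelmerInfty_ordinary_rat p W hgo κ hκ hγ hK, Nat.cast_one,
    mul_one] at hu
  rw [hu, natCard_kerG_zero_eq_prod W p κ hκ ‹_› hE S hS, Nat.cast_prod]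

end Summit.BirchSwinnertonDyer.BirchSwinnertonDyer.Theorems.InputsGreenbergKerG

end
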